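import Summits.QuantumFields.BalabanUV.Beta.D1BFx.RJetProjector
import Summits.QuantumFields.BalabanUV.Beta.D1BFx.TorusTraceTadpole

/-!
# `BalabanUV.Beta.D1BFx.TorusGhostGram` — road «BF-x» for binder row D1, slot (K), X₃(ii) ROUTE T, brick **K-TB3c PART 1, FILE 2∕2**
# «THE SCALAR GHOST LEGS ON THE TORUS — THE COARSE GRAM»: pv23's `Q′G′²Q′*` kernel `kerSq` and «the operator C» `Csq = (Q′G′²Q′*)⁻¹` on the
# COARSE lattice `ℤ⁴`, read in the road's `MKer 4 Unit` currency (`KsqK`, `CsqK`), are FULLY TRANSLATION INVARIANT (d1-formalise-leaf-05-g3's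
# `RJetProjector.Csq_translate`, BY NAME), hence jointly `q`-periodic for EVERY `q`; on every coarse torus `Site 4 q` the periodised
# `C` IS the torus inverse of the periodised `Q′G′²Q′*` (the LEG LETTER `(KsqK)^·(CsqK)^ = 1 = (CsqK)^·(KsqK)^`, with uniqueness), and its torus
# one-loop functionals against periodised arrays converge to the `ℤ⁴` ones (the SOCKETS `hessT → hessKer`, TA3b at `F = Unit`).
# FILE 1∕2 = `D1BFx/TorusGhostLegs` (the tower leg `(Ggh)^` on the fine torus).

HONEST DEPENDENCY (cell records, verbatim): «continuum YM on T⁴ ⇐ BetaPertH ∧ nine spine estimates (0/9 proved); BetaPertH ⇐ (D1) ∧ (D4) ∧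
CAP+tail; G-an2-4 gates asym, D1 and NE2/3/4.»  HONEST FRAMING (cell contract, verbatim): «discharging `BetaPertH` makes Bałaban's UV stability
UNCONDITIONAL — a real constructive-QFT result; it is NOT the continuum limit and NOT the Clay problem.»  THIS MODULE DISCHARGES NOTHING of (K),
of D1 or of the wall: [folklore] absolutely convergent lattice bookkeeping over pv23's `B6QGGQ278Zd` (`kerSq`, `Csq`, `KerSq`, `abs_kerSq_le`,
`abs_Csq_le`, `tsum_Csq_mul_kerSq`, constants `cSq`, `deltaSq`, `cC`, `deltaC`), d1-formalise-leaf-05-g3's `RJetProjector` (`kerSq_translate`,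
`Csq_translate` — the translation invariance of `Q′G′²Q′*` and of «the operator C» via the uniqueness of the bounded whole-lattice inverse), the D1
typer's `GhostLeg` (`l1_sub_le_four_mul_dist`), leaf-09-g2's `RProjector` (`Csq_symm`, `tsum_kerSq_mul_Csq`), leaf-03-g7's `FibredPeriodisation`
(`lemma222F`, `eq_periodiseF_of_mul_eq_one(′)`,
`periodiseF_transpose`), brick TA2 `PeriodicArrays` and brick TA3b `TorusTraceTadpole` — all USED BY NAME.  Two re-indexing definitions
[our object] (`KsqK`, `CsqK`; no `def … : Prop`), nothing cited, 0 sorry.  NOT D1, NOT BetaPertH, NOT continuum, NOT Clay.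

ABSOLUTE RULE (cell charter, verbatim): «No internally-minted statement may enter as a cited fact. Every hypothesis is either kernel-proved in this
package or a verbatim quotation of a PUBLISHED theorem with page reference. The manuscript(s) under audit are NOT citable for their own disputed
steps — they are the thing under adjudication; programme-internal (2001/route/tribunal) claims are never citable.»

WHERE THIS SITS (`HOME/b2b-balaban-beta-d1-p2/K-ASSEMBLY-SPEC-v2.md` v2.2 §2 row K-TB3c «GHOST LEGS ON THE TORUS → ℤ⁴», «OPEN — after K-TB3a»;
`OWNER-MEMO-g6.md` §2; v2.1 amendments: `h[Φ] = h[NᵀΔ_U²N] … = h[kkt ((Δ_U + Q′ᵀaQ′)²) Q′] = 2h[G′] + h[Csq]`).  After K-TB3a the ghost side of the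
owner's DECISION 2 reads, on every torus, `2·hessT(M̂₀⁻¹; M-jets) + hessT(Ŝ₀⁻¹; S-jets)` with `S₀ = Q′M₀⁻²Q′ᵀ` on COARSE sites, whose `ℤ⁴`
kernel is pv23's `kerSq` (up to the road's normalisation, K-TB3c PART 2) and whose inverse is «the operator C».  THIS FILE (§-numbers continue
FILE 1):
* §3.1 [folklore] `exp_dist_le_exp_l1` (a sup-norm rate `δ` is an `ℓ¹` rate `δ∕4` on `ℤ⁴`); the translation invariance `kerSq_translate`∕
  `Csq_translate` (for EVERY `t ∈ ℤ⁴`) is `RJetProjector`'s, USED BY NAME.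
* §3.2 [our object] `KsqK n a`, `CsqK n a : MKer 4 Unit` := `kerSq (n−1) a`, `Csq (n−1) a` re-indexed (road block side `n ≥ 1` as in
  `GhostLeg`∕`RProjector.Pgt`); [folklore] symmetry, `shiftK t · = ·` for EVERY `t`, `CsqK_imageShift`∕`isPeriodic₂_CsqK` for EVERY period,
  `decays_KsqK`∕`decays_CsqK` (rates `deltaSq 4 a ∕ 4`, `deltaC 4 a ∕ 4`), row bounds, `compF (toF KsqK) (toF CsqK) = kdeltaF` (both orders), THE
  COARSE-TORUS LETTER **`periodiseF_KsqK_mul_CsqK`**: `(KsqK)^·(CsqK)^ = 1 ∧ (CsqK)^·(KsqK)^ = 1` on `Site 4 q × Unit` for EVERY `q` (no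
  divisibility condition), uniqueness corollaries, `isUnit_det`, `((KsqK)^)⁻¹ = (CsqK)^`, `(CsqK)^ᵀ = (CsqK)^`.
* §4 [folklore] THE COARSE-TORUS SOCKETS along any `q k → ∞`: the product rule `(CsqK)^·(arr W)^ = (arr (CsqK ∘ W))^`, `tr_T → tadpole`, the bubble
  twin, and **`tendsto_hessT_CsqK`**: `hessT (CsqK)^ (arr (𝒱 μ 0))^ (arr (𝒱 ν z))^ (arr (𝒲 μ 0 ν z))^ → hessKer (CsqK n a) 𝒱 𝒲 μ ν z`.
NOT HERE (K-TB3c PART 2, not claimed): `Q̂′·((Ggh)^)²·Q̂′ᵀ = n⁴•(KsqK)^` on the torus (scalar twin of 3b-Q(ii) `TorusAveragingGram`), the S-jets as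
periodised coarse arrays of the unit-class Gram rows (dictionary of record, after TB4-tables), sorted-currency re-indexing.
Provenance: NE9 formalisation swarm leaf seat `b2b-balaban-t4-ne9-formalise-leaf-09` gen 38 (cross-row prover duty NE9 → β∕D1 road «BF-x»; journal
CLAIM + SHAPE l.22755), 2026-08-20.
-/

noncomputable section

namespace Summit.QuantumFields.BalabanUV.Beta.D1BFx.TorusGhostGram

open Filter Topology
open scoped BigOperators
open Literature.MathematicalPhysics.QuantumFieldTheory.Balaban1983to89
open Literature.MathematicalPhysics.QuantumFieldTheory.Balaban1983to89.Beta
open B12Sec2to5 (l1)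
open B6QGGQ278Zd (kerSq Csq cC deltaC cC_pos deltaC_pos cSq deltaSq cSq_pos deltaSq_pos abs_Csq_le abs_kerSq_le tsum_Csq_mul_kerSq)
open ExpKernelCalculus (Site MKer Decays BiLoc comp bubble tadpole hessKer shiftK)
open Summit.QuantumFields.BalabanUV.Beta.D1BFx.FibredPeriodisation (Kfib kdeltaF compF periodiseF lemma222F eq_periodiseF_of_mul_eq_one
  eq_periodiseF_of_mul_eq_one' periodiseF_transpose)
open Summit.QuantumFields.BalabanUV.Beta.D1BFx.PeriodicArrays (arr toF toF_apply Kfib_toF imageShift_eq_add_smul)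
open Summit.QuantumFields.BalabanUV.Beta.D1BFx.MixedVarPackedHess (hessT)
open Summit.QuantumFields.BalabanUV.Beta.D1BFx.GhostLeg (l1_sub_le_four_mul_dist)
open Summit.QuantumFields.BalabanUV.Beta.D1BFx.RProjector (Csq_symm tsum_kerSq_mul_Csq)
open Summit.QuantumFields.BalabanUV.Beta.D1BFx.RJetProjector (kerSq_translate Csq_translate)
open Summit.QuantumFields.BalabanUV.Beta.D1BFx.TorusTraceTadpole (tendsto_trace_tadpole tendsto_trace_bubble tendsto_hessT_hessKer
  periodiseF_toF_mul_arr summable_abs_row_toF)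

/-! ## §3 The coarse Gram `Q′G′²Q′*` and «the operator C» on the coarse torus -/

section Translation

/-! ### §3.1 Rates: sup-norm decay read in the road's `ℓ¹` currency (the translation invariance itself — `gq_translate`, `kerSq_translate`,
`Csq_translate` — is d1-formalise-leaf-05-g3's `RJetProjector` §3, USED BY NAME) -/

variable {a : ℝ}

/-- [folklore] `ℓ¹ ≤ 4·sup` turned into a comparison of exponential weights: a `dist`-rate `δ` bound is an `ℓ¹`-rate `δ∕4` bound on `ℤ⁴`. -/
theorem exp_dist_le_exp_l1 {δ : ℝ} (hδ : 0 ≤ δ) (x y : Site 4) : Real.exp (-(δ * dist x y)) ≤ Real.exp (-(δ / 4) * l1 (x - y)) := by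
  rw [Real.exp_le_exp]
  have h := l1_sub_le_four_mul_dist x y
  nlinarith

end Translation

section CoarseGram

/-! ### §3.2 The two coarse kernels in the road's currency, their letters on every coarse torus -/

variable (n : ℕ) [NeZero n] (a : ℝ)

/-- [our object] **THE COARSE GRAM `Q′G′²Q′*` AS A ROAD KERNEL** on the COARSE lattice `ℤ⁴` (block labels): `KsqK n a y y′ () () := kerSq (n − 1) a y y′ =
n⁻⁴·Σ'_r (G′Q′*)(r,y)(G′Q′*)(r,y′)` (pv23's `B6QGGQ278Zd.kerSq` at the road's block side `n`).  A re-indexing; asserts nothing. -/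
def KsqK : MKer 4 Unit := fun y y' _ _ => kerSq (d := 4) (n - 1) a y y'

/-- [our object] **«THE OPERATOR C» AS A ROAD KERNEL**: `CsqK n a y y′ () () := Csq (n − 1) a y y′`, the B4-Sect.-5 whole-lattice inverse kernel of
`Q′G′²Q′*` (pv23's `B6QGGQ278Zd.Csq`).  A re-indexing; asserts nothing. -/
def CsqK : MKer 4 Unit := fun y y' _ _ => Csq (d := 4) (n - 1) a y y'

omit [NeZero n] in
/-- [our object] Unfolding `KsqK`. -/
@[simp] theorem KsqK_apply (y y' : Site 4) (u v : Unit) : KsqK n a y y' u v = kerSq (d := 4) (n - 1) a y y' := rfl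

omit [NeZero n] in
/-- [our object] Unfolding `CsqK`. -/
@[simp] theorem CsqK_apply (y y' : Site 4) (u v : Unit) : CsqK n a y y' u v = Csq (d := 4) (n - 1) a y y' := rfl

omit [NeZero n] in
/-- [folklore] `KsqK` is symmetric (`kerSq_symm`). -/
theorem KsqK_symm (y y' : Site 4) (u v : Unit) : KsqK n a y y' u v = KsqK n a y' y v u :=
  B6QGGQ278Zd.kerSq_symm (n - 1) a y y'

omit [NeZero n] in
/-- [folklore] `CsqK` is symmetric (`RProjector.Csq_symm`). -/
theorem CsqK_symm (ha : 0 < a) (y y' : Site 4) (u v : Unit) : CsqK n a y y' u v = CsqK n a y' y v u :=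
  Csq_symm (n - 1) ha y y'

omit [NeZero n] in
/-- [folklore] **FULL TRANSLATION INVARIANCE** `shiftK t (KsqK n a) = KsqK n a` for every `t ∈ ℤ⁴` (`RJetProjector.kerSq_translate`). -/
theorem shiftK_KsqK (ha : 0 < a) (t : Site 4) : shiftK t (KsqK n a) = KsqK n a := by
  funext y y' u v
  exact kerSq_translate (n - 1) ha t y y'

omit [NeZero n] in
/-- [folklore] **FULL TRANSLATION INVARIANCE** `shiftK t (CsqK n a) = CsqK n a` for every `t ∈ ℤ⁴` (`RJetProjector.Csq_translate`). -/
theorem shiftK_CsqK (ha : 0 < a) (t : Site 4) : shiftK t (CsqK n a) = CsqK n a := by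
  funext y y' u v
  exact Csq_translate (n - 1) ha t y y'

omit [NeZero n] in
/-- [folklore] … hence joint `s`-periodicity for EVERY period `s` (the `hAper` hypothesis of TA3b on the coarse torus). -/
theorem CsqK_imageShift (ha : 0 < a) (s : ℕ) (x y t : Site 4) (u v : Unit) :
    CsqK n a (imageShift s x t) (imageShift s y t) u v = CsqK n a x y u v := by
  rw [imageShift_eq_add_smul, imageShift_eq_add_smul]
  exact Csq_translate (n - 1) ha _ x y

omit [NeZero n] in
/-- [folklore] … in an4's vocabulary: every fibre of `toF (CsqK n a)` is `IsPeriodic₂ s`, every `s`. -/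
theorem isPeriodic₂_CsqK (ha : 0 < a) (s : ℕ) (u v : Unit) : IsPeriodic₂ s (Kfib (toF (CsqK n a)) u v) :=
  fun x y t => CsqK_imageShift n a ha s x y t u v

omit [NeZero n] in
/-- [folklore] **DECAY OF `Q′G′²Q′*` IN THE ROAD's `ℓ¹` CURRENCY**: `Decays (KsqK n a) (cSq 4 a) (deltaSq 4 a ∕ 4)` (pv23's MESH-FREE `abs_kerSq_le`). -/
theorem decays_KsqK (ha : 0 < a) : Decays (KsqK n a) (cSq 4 a) (deltaSq 4 a / 4) := fun y y' _ _ =>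
  (abs_kerSq_le (n - 1) ha y y').trans
    (mul_le_mul_of_nonneg_left (exp_dist_le_exp_l1 (deltaSq_pos 4 ha).le y y') (cSq_pos 4 ha).le)

omit [NeZero n] in
/-- [folklore] **DECAY OF «THE OPERATOR C» IN THE ROAD's `ℓ¹` CURRENCY**: `Decays (CsqK n a) (cC 4 a) (deltaC 4 a ∕ 4)` (pv23's MESH-FREE (2.79) shadow
`abs_Csq_le`). -/
theorem decays_CsqK (ha : 0 < a) : Decays (CsqK n a) (cC 4 a) (deltaC 4 a / 4) := fun y y' _ _ =>
  (abs_Csq_le (n - 1) ha y y').trans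
    (mul_le_mul_of_nonneg_left (exp_dist_le_exp_l1 (deltaC_pos 4 ha).le y y') (cC_pos 4 ha).le)

omit [NeZero n] in
/-- [folklore] Absolutely summable rows of the fibres of `KsqK` (LEFT-factor hypothesis of `lemma222F`). -/
theorem summable_abs_row_KsqK (ha : 0 < a) (u v : Unit) (x : Site 4) : Summable fun y : Site 4 => |Kfib (toF (KsqK n a)) u v x y| :=
  summable_abs_row_toF (decays_KsqK n a ha) (div_pos (deltaSq_pos 4 ha) four_pos) u v x

omit [NeZero n] in
/-- [folklore] A UNIFORM `ℓ¹` ROW BOUND for the fibres of `CsqK` (RIGHT-factor hypothesis of `lemma222F`). -/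
theorem rowBound_CsqK (ha : 0 < a) (u v : Unit) :
    RowBound (Kfib (toF (CsqK n a)) u v) (cC 4 a * ∑' w : Site 4, Real.exp (-(deltaC 4 a / 4) * l1 w)) := by
  have h2 : Decay₂ (Kfib (toF (CsqK n a)) u v) (cC 4 a) (deltaC 4 a / 4) := fun x y => by
    rw [Kfib_toF]; exact decays_CsqK n a ha x y u v
  exact h2.rowBound (div_pos (deltaC_pos 4 ha) four_pos)

omit [NeZero n] in
/-- [folklore] **`(Q′G′²Q′*) ∘ C = 𝟙` IN FIBRED-KERNEL FORM** (`RProjector.tsum_kerSq_mul_Csq` BY NAME). -/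
theorem compF_KsqK_CsqK (ha : 0 < a) : compF (toF (KsqK n a)) (toF (CsqK n a)) = kdeltaF := by
  funext i j
  obtain ⟨x, u⟩ := i
  obtain ⟨y, v⟩ := j
  simp only [compF, toF_apply, KsqK_apply, CsqK_apply, Finset.univ_unique, Finset.sum_singleton, kdeltaF, Prod.mk.injEq]
  rw [tsum_kerSq_mul_Csq (n - 1) ha x y]
  by_cases h : x = y
  · simp [h]
  · simp [h]

omit [NeZero n] in
/-- [folklore] **`C ∘ (Q′G′²Q′*) = 𝟙` IN FIBRED-KERNEL FORM** (pv23's `tsum_Csq_mul_kerSq` BY NAME). -/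
theorem compF_CsqK_KsqK (ha : 0 < a) : compF (toF (CsqK n a)) (toF (KsqK n a)) = kdeltaF := by
  funext i j
  obtain ⟨x, u⟩ := i
  obtain ⟨y, v⟩ := j
  simp only [compF, toF_apply, KsqK_apply, CsqK_apply, Finset.univ_unique, Finset.sum_singleton, kdeltaF, Prod.mk.injEq]
  rw [tsum_Csq_mul_kerSq (n - 1) ha x y]
  by_cases h : x = y
  · simp [h]
  · simp [h]

variable {q : ℕ} [NeZero q]

omit [NeZero n] in
/-- [folklore] **THE COARSE-TORUS LETTER OF «THE OPERATOR C»** (Lemma 2.2.2 for `Q′G′²Q′*`): on EVERY coarse torus `Site 4 q`,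
`(KsqK)^ · (CsqK)^ = 1` AND `(CsqK)^ · (KsqK)^ = 1` — the periodised `C` IS the torus inverse of the periodised `Q′G′²Q′*`
(`FibredPeriodisation.lemma222F` on `compF_KsqK_CsqK`; no divisibility condition: both kernels are fully translation invariant). -/
theorem periodiseF_KsqK_mul_CsqK (ha : 0 < a) :
    Matrix.of (periodiseF q (toF (KsqK n a))) * Matrix.of (periodiseF q (toF (CsqK n a))) = 1 ∧
      Matrix.of (periodiseF q (toF (CsqK n a))) * Matrix.of (periodiseF q (toF (KsqK n a))) = 1 :=
  lemma222F (summable_abs_row_KsqK n a ha) (isPeriodic₂_CsqK n a ha q) (rowBound_CsqK n a ha) (compF_KsqK_CsqK n a ha)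

omit [NeZero n] in
/-- [folklore] **UNIQUENESS, RIGHT FORM**: any right inverse of `(KsqK)^` on the coarse torus is `(CsqK)^`. -/
theorem eq_periodiseF_CsqK_of_mul_eq_one (ha : 0 < a) {G : Matrix (Site 4 q × Unit) (Site 4 q × Unit) ℝ}
    (hG : Matrix.of (periodiseF q (toF (KsqK n a))) * G = 1) : G = Matrix.of (periodiseF q (toF (CsqK n a))) :=
  eq_periodiseF_of_mul_eq_one (summable_abs_row_KsqK n a ha) (isPeriodic₂_CsqK n a ha q) (rowBound_CsqK n a ha)
    (compF_KsqK_CsqK n a ha) hG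

omit [NeZero n] in
/-- [folklore] **UNIQUENESS, LEFT FORM**: any left inverse of `(KsqK)^` on the coarse torus is `(CsqK)^`. -/
theorem eq_periodiseF_CsqK_of_mul_eq_one' (ha : 0 < a) {G : Matrix (Site 4 q × Unit) (Site 4 q × Unit) ℝ}
    (hG : G * Matrix.of (periodiseF q (toF (KsqK n a))) = 1) : G = Matrix.of (periodiseF q (toF (CsqK n a))) :=
  eq_periodiseF_of_mul_eq_one' (summable_abs_row_KsqK n a ha) (isPeriodic₂_CsqK n a ha q) (rowBound_CsqK n a ha)
    (compF_KsqK_CsqK n a ha) hG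

omit [NeZero n] in
/-- [folklore] The periodised `Q′G′²Q′*` is invertible on every coarse torus. -/
theorem isUnit_det_periodiseF_KsqK (ha : 0 < a) : IsUnit (Matrix.of (periodiseF q (toF (KsqK n a)))).det :=
  Matrix.isUnit_det_of_right_inverse (periodiseF_KsqK_mul_CsqK n a (q := q) ha).1

omit [NeZero n] in
/-- [folklore] … hence `((KsqK)^)⁻¹ = (CsqK)^` as a matrix inverse. -/
theorem inv_periodiseF_KsqK (ha : 0 < a) :
    (Matrix.of (periodiseF q (toF (KsqK n a))))⁻¹ = Matrix.of (periodiseF q (toF (CsqK n a))) :=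
  Matrix.inv_eq_right_inv (periodiseF_KsqK_mul_CsqK n a (q := q) ha).1

omit [NeZero n] in
/-- [folklore] **SYMMETRY OF THE PERIODISED «OPERATOR C»**: `(CsqK)^ᵀ = (CsqK)^`. -/
theorem periodiseF_CsqK_transpose (ha : 0 < a) :
    (Matrix.of (periodiseF q (toF (CsqK n a)))).transpose = Matrix.of (periodiseF q (toF (CsqK n a))) := by
  ext ⟨x, u⟩ ⟨y, v⟩
  rw [Matrix.transpose_apply, Matrix.of_apply, Matrix.of_apply]
  have e : toF (CsqK n a) = fun i j => toF (CsqK n a) j i := by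
    funext i j
    obtain ⟨x', u'⟩ := i
    obtain ⟨y', v'⟩ := j
    rw [toF_apply, toF_apply]
    exact CsqK_symm n a ha x' y' u' v'
  conv_lhs => rw [e]
  exact periodiseF_transpose (isPeriodic₂_CsqK n a ha q) x y u v

end CoarseGram

/-! ## §4 The coarse-torus sockets of «the operator C» (TA3b at `F = Unit`, any periods `q k → ∞`) -/

section CoarseSockets

variable (n : ℕ) (a : ℝ) {V V' W : MKer 4 Unit} {P Q P' Q' : Site 4} {C Cv Cv' δ : ℝ} {q : ℕ → ℕ} [∀ k, NeZero (q k)]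

/-- [folklore] **THE TORUS PRODUCT RULE FOR «THE OPERATOR C»**: `(CsqK)^ · (arr s W)^ = (arr s (CsqK ∘ W))^` on every coarse torus `Site 4 s`. -/
theorem periodiseF_CsqK_mul_arr (ha : 0 < a) {s : ℕ} [NeZero s] (hW : BiLoc W P Q C δ) (hδ : 0 < δ) :
    Matrix.of (periodiseF s (toF (CsqK n a))) * Matrix.of (periodiseF s (toF (arr s W))) =
      Matrix.of (periodiseF s (toF (arr s (comp (CsqK n a) W)))) :=
  periodiseF_toF_mul_arr (decays_CsqK n a ha) (div_pos (deltaC_pos 4 ha) four_pos) (fun x y t u v => CsqK_imageShift n a ha s x y t u v) hW hδ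

/-- [folklore] **COARSE TADPOLE SOCKET**: along coarse tori `Site 4 (q k)`, `q k → ∞`, `tr_T((CsqK)^ · (arr W)^) → tadpole (CsqK n a) W`. -/
theorem tendsto_trace_tadpole_CsqK (ha : 0 < a) (hW : BiLoc W P Q C δ) (hδ : 0 < δ) (hq : Tendsto q atTop atTop) :
    Tendsto (fun k => Matrix.trace (Matrix.of (periodiseF (q k) (toF (CsqK n a))) *
        Matrix.of (periodiseF (q k) (toF (arr (q k) W))))) atTop (𝓝 (tadpole (CsqK n a) W)) :=
  tendsto_trace_tadpole (σ := q) (decays_CsqK n a ha) (div_pos (deltaC_pos 4 ha) four_pos)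
    (fun k x y t u v => CsqK_imageShift n a ha (q k) x y t u v) hW hδ hq

/-- [folklore] **COARSE BUBBLE SOCKET**: `tr_T(((CsqK)^(arr V)^)((CsqK)^(arr V′)^)) → bubble (CsqK n a) V V′`. -/
theorem tendsto_trace_bubble_CsqK (ha : 0 < a) (hV : BiLoc V P P' Cv δ) (hV' : BiLoc V' Q' Q Cv' δ) (hδ : 0 < δ)
    (hq : Tendsto q atTop atTop) :
    Tendsto (fun k => Matrix.trace (Matrix.of (periodiseF (q k) (toF (CsqK n a))) * Matrix.of (periodiseF (q k) (toF (arr (q k) V))) *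
        (Matrix.of (periodiseF (q k) (toF (CsqK n a))) * Matrix.of (periodiseF (q k) (toF (arr (q k) V'))))))
      atTop (𝓝 (bubble (CsqK n a) V V')) :=
  tendsto_trace_bubble (σ := q) (decays_CsqK n a ha) (div_pos (deltaC_pos 4 ha) four_pos)
    (fun k x y t u v => CsqK_imageShift n a ha (q k) x y t u v) hV hV' hδ hq

/-- [folklore] **THE COARSE HESS SOCKET — THE POINT OF §4**: for scalar base-point families `𝒱`, `𝒲` on the coarse lattice (bi-localised at a common rate),
`hessT (CsqK)^ (arr (𝒱 μ 0))^ (arr (𝒱 ν z))^ (arr (𝒲 μ 0 ν z))^ → hessKer (CsqK n a) 𝒱 𝒲 μ ν z` along any coarse tori `Site 4 (q k)`, `q k → ∞`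
(TA3b `tendsto_hessT_hessKer` at `F = Unit`; the unit-class Gram functional of the owner's DECISION 2). -/
theorem tendsto_hessT_CsqK (ha : 0 < a) (𝒱 : Fin 4 → Site 4 → MKer 4 Unit) (𝒲 : Fin 4 → Site 4 → Fin 4 → Site 4 → MKer 4 Unit)
    (μ ν : Fin 4) (z : Site 4) (hV : BiLoc (𝒱 μ 0) P P' Cv δ) (hV' : BiLoc (𝒱 ν z) Q' Q Cv' δ) (hW : BiLoc (𝒲 μ 0 ν z) P Q C δ)
    (hδ : 0 < δ) (hq : Tendsto q atTop atTop) :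
    Tendsto (fun k => hessT (Matrix.of (periodiseF (q k) (toF (CsqK n a))))
        (Matrix.of (periodiseF (q k) (toF (arr (q k) (𝒱 μ 0)))))
        (Matrix.of (periodiseF (q k) (toF (arr (q k) (𝒱 ν z)))))
        (Matrix.of (periodiseF (q k) (toF (arr (q k) (𝒲 μ 0 ν z))))))
      atTop (𝓝 (hessKer (CsqK n a) 𝒱 𝒲 μ ν z)) :=
  tendsto_hessT_hessKer (σ := q) (decays_CsqK n a ha) (div_pos (deltaC_pos 4 ha) four_pos)
    (fun k x y t u v => CsqK_imageShift n a ha (q k) x y t u v) 𝒱 𝒲 μ ν z hV hV' hW hδ hq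

end CoarseSockets


end Summit.QuantumFields.BalabanUV.Beta.D1BFx.TorusGhostGram

end
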